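import Mathlib
import HarnessLib

/-!
# Single-linkage clustering at geometric scales has a good scale (combinatorics for the bounded-fan-in sub-rung, XXIII)

Route MonotoneRestoration, crux `OrbitRestorationQP` (stmt-ValiantsHypothesis-18293), line `depth-three-rung`, registered stub
`stub_sigmaPiSigmaKValue` (A_k).  Namespace `Summit.ValiantsHypothesis.ValiantsHypothesis.Theorems.RankClustering`.  Route-independent.

Layer L3a of the Structure Theorem (crux workfile `Lines/depth-three-rung-stubA-bounded-fanin.md` §2(a), §8): the Karnin–Shpilka
single-linkage clustering of the `k` product terms of a `ΣΠΣ(k)` circuit by a pseudo-metric `Δ` (the rank distance) — two terms are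
LINKED at scale `θ` if they are joined by a chain of steps of `Δ`-length `≤ θ` (`Relation.ReflTransGen (Δ · · ≤ θ)`) — and the
existence of a GOOD scale among `θ_m = (2k+2)^m (R+1)`, `m ≤ k²`: one at which any two terms at distance `≤ 2R + 2(k−1)θ_m` are
already linked.  Purely combinatorial, no definitions (statements are spelled out over Mathlib's `Relation.ReflTransGen`):

* `dist_le_of_linked` — linked terms are at distance `≤ (k−1)·θ` (triangle inequality; `k = |ι|`);
* `threshold_le_scale_succ` — the merge threshold of scale `m` is below scale `m+1`;
* `exists_good_scale` — some `m ≤ k²` is good (each bad scale strictly decreases the number of unlinked pairs).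

Everything is proved. [folklore; cite: KarninShpilka2009 (rank-distance clustering), SaxenaSeshadhri2013]
-/

-- `Summit.ValiantsHypothesis.ValiantsHypothesis.…` is the tree's single-conjunct layout (Sub = Summit).
set_option linter.dupNamespace false

open scoped Classical

namespace Summit.ValiantsHypothesis.ValiantsHypothesis.Theorems

namespace RankClustering

open Finset

variable {ι : Type} (Δ : ι → ι → ℕ)

/-- Linkage is monotone in the scale. [folklore] -/
theorem linked_mono {θ θ' : ℕ} (h : θ ≤ θ') {i j : ι} (hij : Relation.ReflTransGen (fun a b => Δ a b ≤ θ) i j) :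
    Relation.ReflTransGen (fun a b => Δ a b ≤ θ') i j := by
  induction hij with
  | refl => exact Relation.ReflTransGen.refl
  | tail _ hbc ih => exact Relation.ReflTransGen.tail ih (le_trans hbc h)

/-- Linkage is symmetric when `Δ` is. [folklore] -/
theorem linked_symm (hsymm : ∀ i j, Δ i j = Δ j i) {θ : ℕ} {i j : ι}
    (hij : Relation.ReflTransGen (fun a b => Δ a b ≤ θ) i j) : Relation.ReflTransGen (fun a b => Δ a b ≤ θ) j i := by
  induction hij with
  | refl => exact Relation.ReflTransGen.refl
  | tail _ hbc ih => exact Relation.ReflTransGen.head (by rw [hsymm]; exact hbc) ih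

variable [Fintype ι]

/-- **Diameter bound**: linked terms are at distance `≤ (|ι| − 1)·θ`.  (Along a chain from `i` collect the visited terms in a
finite set `S` with `Δ i l ≤ (|S| − 1)θ` for all `l ∈ S`; a new term costs one more `θ` and enlarges `S`.) [folklore] -/
theorem dist_le_of_linked (htri : ∀ i j l, Δ i l ≤ Δ i j + Δ j l) (hrefl : ∀ i, Δ i i = 0) {θ : ℕ} {i j : ι}
    (h : Relation.ReflTransGen (fun a b => Δ a b ≤ θ) i j) : Δ i j ≤ (Fintype.card ι - 1) * θ := by
  have key : ∃ S : Finset ι, j ∈ S ∧ ∀ l ∈ S, Δ i l ≤ (S.card - 1) * θ := by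
    induction h with
    | refl => exact ⟨{i}, mem_singleton_self i, fun l hl => by rw [mem_singleton] at hl; rw [hl, hrefl]; exact Nat.zero_le _⟩
    | tail _ hbc ih =>
      rename_i b c _
      obtain ⟨S, hbS, hS⟩ := ih
      by_cases hc : c ∈ S
      · exact ⟨S, hc, hS⟩
      · refine ⟨insert c S, mem_insert_self c S, fun l hl => ?_⟩
        have hcard : (insert c S).card = S.card + 1 := card_insert_of_notMem hc
        have hSpos : 1 ≤ S.card := card_pos.2 ⟨b, hbS⟩
        rw [hcard]
        rcases mem_insert.1 hl with rfl | hl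
        · calc Δ i l ≤ Δ i b + Δ b l := htri i b l
            _ ≤ (S.card - 1) * θ + θ := Nat.add_le_add (hS b hbS) hbc
            _ = (S.card + 1 - 1) * θ := by
                rw [show S.card + 1 - 1 = (S.card - 1) + 1 by omega, Nat.add_mul, one_mul]
        · exact (hS l hl).trans (Nat.mul_le_mul_right θ (by omega))
  obtain ⟨S, hjS, hS⟩ := key
  exact (hS j hjS).trans (Nat.mul_le_mul_right θ (Nat.sub_le_sub_right (card_le_univ S) 1))

/-- The merge threshold of scale `m`, `2R + 2(|ι|−1)·θ_m` with `θ_m = (2|ι|+2)^m (R+1)`, is at most `θ_{m+1}`. [folklore] -/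
theorem threshold_le_scale_succ (R m : ℕ) :
    2 * R + 2 * (Fintype.card ι - 1) * ((2 * Fintype.card ι + 2) ^ m * (R + 1)) ≤
      (2 * Fintype.card ι + 2) ^ (m + 1) * (R + 1) := by
  set k := Fintype.card ι
  set θ := (2 * k + 2) ^ m * (R + 1) with hθ
  have h1 : R + 1 ≤ θ := by rw [hθ]; exact Nat.le_mul_of_pos_left _ (pow_pos (by omega) m)
  have : 2 * R ≤ 2 * θ := by omega
  calc 2 * R + 2 * (k - 1) * θ ≤ 2 * θ + 2 * (k - 1) * θ := Nat.add_le_add_right this _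
    _ = (2 + 2 * (k - 1)) * θ := by ring
    _ ≤ (2 * k + 2) * θ := Nat.mul_le_mul_right _ (by omega)
    _ = (2 * k + 2) ^ (m + 1) * (R + 1) := by rw [hθ, pow_succ]; ring

/-- **A GOOD SCALE EXISTS**: for some `m ≤ |ι|²`, any two terms at distance `≤ 2R + 2(|ι|−1)·θ_m` are linked at scale
`θ_m = (2|ι|+2)^m (R+1)`.  (A bad scale has an unlinked pair that becomes linked at the next scale, so the number of unlinked pairs
— at most `|ι|²` — strictly decreases.) [folklore] -/
theorem exists_good_scale (R : ℕ) :
    ∃ m, m ≤ Fintype.card ι ^ 2 ∧ ∀ i j : ι,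
      Δ i j ≤ 2 * R + 2 * (Fintype.card ι - 1) * ((2 * Fintype.card ι + 2) ^ m * (R + 1)) →
        Relation.ReflTransGen (fun a b => Δ a b ≤ (2 * Fintype.card ι + 2) ^ m * (R + 1)) i j := by
  set k := Fintype.card ι with hk
  -- the number of unlinked pairs at scale `m`
  set U : ℕ → Finset (ι × ι) := fun m => univ.filter fun p : ι × ι =>
    ¬ Relation.ReflTransGen (fun a b => Δ a b ≤ (2 * k + 2) ^ m * (R + 1)) p.1 p.2 with hU
  have hanti : ∀ m, U (m + 1) ⊆ U m := by
    intro m p hp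
    simp only [hU, mem_filter, mem_univ, true_and] at hp ⊢
    intro hl
    exact hp (linked_mono Δ (Nat.mul_le_mul_right _ (Nat.pow_le_pow_right (by omega) (Nat.le_succ m))) hl)
  by_contra hno
  simp only [not_exists, not_and] at hno
  -- every `m ≤ k²` is bad, so `|U m|` drops by one at each step
  have hdrop : ∀ m ≤ k ^ 2 + 1, (U m).card + m ≤ k ^ 2 := by
    intro m hm
    induction m with
    | zero =>
      simp only [add_zero]
      calc (U 0).card ≤ (univ : Finset (ι × ι)).card := card_le_univ _
        _ = k ^ 2 := by rw [card_univ, Fintype.card_prod, hk, sq]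
    | succ m ih =>
      have ih' := ih (by omega)
      have hbad := hno m (by omega)
      simp only [not_forall, exists_prop] at hbad
      obtain ⟨i, j, hij, hnl⟩ := hbad
      have hss : U (m + 1) ⊂ U m := by
        refine lt_of_le_of_ne (hanti m) fun heq => ?_
        have hmem : (i, j) ∈ U m := by simp only [hU, mem_filter, mem_univ, true_and]; exact hnl
        rw [← heq] at hmem
        simp only [hU, mem_filter, mem_univ, true_and] at hmem
        exact hmem (Relation.ReflTransGen.single (hij.trans (threshold_le_scale_succ R m)))
      have := card_lt_card hss
      omega
  have := hdrop (k ^ 2 + 1) le_rfl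
  omega

end RankClustering

end Summit.ValiantsHypothesis.ValiantsHypothesis.Theorems
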